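import Mathlib.Algebra.Lie.Rank
import Mathlib.Algebra.Lie.Abelian
import Mathlib.LinearAlgebra.Dimension.Finrank
import HarnessLib

/-!
# Invariance of the rank and of the dimension of the centre of a Lie algebra

Topic `Algebra/Lie`; namespace `Literature.Algebra.Lie`.  Theorems only (no definition, no named
fact, no `sorry`).

Mathlib defines the **rank** of a finite-dimensional Lie algebra `L` over `K`
(`LieAlgebra.rank K L`, the trailing degree of the characteristic polynomial of a generic
`ad x`; over a field it is the minimal dimension of an Engel subalgebra
`LieSubalgebra.engel K x`, attained exactly at the regular elements —
`LieAlgebra.rank_le_finrank_engel`, `LieAlgebra.isRegular_iff_finrank_engel_eq_rank`,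
`LieAlgebra.exists_isRegular`) and the **centre** `LieAlgebra.center K L`, but records no
invariance statement under isomorphisms.  We prove, for Lie algebras `L`, `L'` over `K`:

* `finrank_engel_eq_of_semilinear`, `finrank_center_eq_of_semilinear`: an additive isomorphism
  `j : L ≃+ L'` with `j ⁅x, y⁆ = ⁅j x, j y⁆` and `j (c • x) = σ c • j x` for a ring automorphism
  `σ : K ≃+* K` (a *`σ`-semilinear isomorphism of Lie algebras*, e.g. a field automorphism
  applied entrywise to a matrix Lie algebra) preserves the dimensions of Engel subalgebras and of
  the centre (through Mathlib's `rank_eq_of_equiv_equiv` for semilinear bijections);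
* `rank_eq_of_semilinear`: hence it preserves `LieAlgebra.rank` when `K` is an infinite field
  (where regular elements exist);
* `rank_eq_of_lieEquiv`, `finrank_center_eq_of_lieEquiv`, `finrank_engel_eq_of_lieEquiv`: the
  case `σ = 1` of an honest isomorphism of Lie algebras `e : L ≃ₗ⁅K⁆ L'`.
* `center_le_engel`, `finrank_center_le_rank`: the centre lies in every Engel subalgebra, so
  `dim 𝔷(L) ≤ rank L` (over an infinite field).

All statements are [folklore] (Bourbaki, *Lie Groups and Lie Algebras*, Ch. VII §2 for the rank).

Tree search: `lean search 'LieAlgebra.rank'` / `'LieAlgebra.center'` finds no use in `Literature/`;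
Mathlib has `LinearEquiv.finrank_eq`, `rank_eq_of_equiv_equiv`, `LieSubalgebra.mem_engel_iff`,
`LieModule.mem_maxTrivSubmodule`, which are what we use.
-/

namespace Literature.Algebra.Lie

universe u v

variable {K : Type u} {L L' : Type v} [CommRing K] [LieRing L] [LieAlgebra K L] [LieRing L']
  [LieAlgebra K L']

/-- Iterated `ad` is transported by a bracket-preserving additive isomorphism:
`ad (j x)^k (j y) = j (ad x ^ k y)`. [folklore] -/
theorem ad_pow_apply_addEquiv (j : L ≃+ L') (hlie : ∀ x y, j ⁅x, y⁆ = ⁅j x, j y⁆) (x y : L)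
    (k : ℕ) : ((LieAlgebra.ad K L' (j x)) ^ k) (j y) = j (((LieAlgebra.ad K L x) ^ k) y) := by
  induction k with
  | zero => simp
  | succ k ih =>
    rw [pow_succ', Module.End.mul_apply, ih, pow_succ', Module.End.mul_apply,
      LieAlgebra.ad_apply, LieAlgebra.ad_apply, hlie]

/-- Engel subalgebras correspond under a bracket-preserving additive isomorphism. [folklore] -/
theorem mem_engel_addEquiv_iff (j : L ≃+ L') (hlie : ∀ x y, j ⁅x, y⁆ = ⁅j x, j y⁆) (x y : L) :
    j y ∈ LieSubalgebra.engel K (j x) ↔ y ∈ LieSubalgebra.engel K x := by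
  rw [LieSubalgebra.mem_engel_iff, LieSubalgebra.mem_engel_iff]
  refine exists_congr fun k => ?_
  rw [ad_pow_apply_addEquiv j hlie, map_eq_zero_iff j j.injective]

/-- **A `σ`-semilinear isomorphism of Lie algebras preserves the dimension of Engel
subalgebras**: `dim engel (j x) = dim engel x`. [folklore] -/
theorem finrank_engel_eq_of_semilinear (σ : K ≃+* K) (j : L ≃+ L')
    (hlie : ∀ x y, j ⁅x, y⁆ = ⁅j x, j y⁆) (hsmul : ∀ (c : K) (x : L), j (c • x) = σ c • j x)
    (x : L) :
    Module.finrank K (LieSubalgebra.engel K (j x)) = Module.finrank K (LieSubalgebra.engel K x) := by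
  -- `j` restricts to a `σ`-semilinear additive isomorphism `engel x ≃+ engel (j x)`
  let J : LieSubalgebra.engel K x ≃+ LieSubalgebra.engel K (j x) :=
    { toFun := fun y => ⟨j (y : L), (mem_engel_addEquiv_iff j hlie x _).mpr y.2⟩
      invFun := fun y' => ⟨j.symm (y' : L'),
        (mem_engel_addEquiv_iff j hlie x _).mp (by rw [j.apply_symm_apply]; exact y'.2)⟩
      left_inv := fun y => Subtype.ext (j.symm_apply_apply (y : L))
      right_inv := fun y' => Subtype.ext (j.apply_symm_apply (y' : L'))
      map_add' := fun a b => Subtype.ext (j.map_add (a : L) (b : L)) }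
  have hJ : ∀ y : LieSubalgebra.engel K x, ((J y : LieSubalgebra.engel K (j x)) : L') = j y :=
    fun _ => rfl
  have hc : ∀ (c : K) (y : LieSubalgebra.engel K x), J (c • y) = σ c • J y := by
    intro c y
    apply Subtype.ext
    rw [hJ, Submodule.coe_smul_of_tower, Submodule.coe_smul_of_tower, hJ]
    exact hsmul c y
  exact (congrArg Cardinal.toNat (rank_eq_of_equiv_equiv (σ : K → K) J σ.bijective hc)).symm

/-- **`LieAlgebra.rank` is invariant under `σ`-semilinear isomorphisms of Lie algebras** over an
infinite field (regular elements exist and the rank is the minimal dimension of an Engel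
subalgebra). [folklore] -/
theorem rank_eq_of_semilinear {K : Type u} {L L' : Type v} [Field K] [Infinite K] [LieRing L]
    [LieAlgebra K L] [Module.Finite K L] [LieRing L'] [LieAlgebra K L'] [Module.Finite K L']
    (σ : K ≃+* K) (j : L ≃+ L') (hlie : ∀ x y, j ⁅x, y⁆ = ⁅j x, j y⁆)
    (hsmul : ∀ (c : K) (x : L), j (c • x) = σ c • j x) :
    LieAlgebra.rank K L = LieAlgebra.rank K L' := by
  obtain ⟨x, hx⟩ := LieAlgebra.exists_isRegular K L
  obtain ⟨x', hx'⟩ := LieAlgebra.exists_isRegular K L'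
  rw [LieAlgebra.isRegular_iff_finrank_engel_eq_rank] at hx hx'
  apply le_antisymm
  · calc LieAlgebra.rank K L
        ≤ Module.finrank K (LieSubalgebra.engel K (j.symm x')) :=
          LieAlgebra.rank_le_finrank_engel K _
      _ = Module.finrank K (LieSubalgebra.engel K x') := by
          rw [← finrank_engel_eq_of_semilinear σ j hlie hsmul (j.symm x'), j.apply_symm_apply]
      _ = LieAlgebra.rank K L' := hx'
  · calc LieAlgebra.rank K L'
        ≤ Module.finrank K (LieSubalgebra.engel K (j x)) := LieAlgebra.rank_le_finrank_engel K _
      _ = Module.finrank K (LieSubalgebra.engel K x) :=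
          finrank_engel_eq_of_semilinear σ j hlie hsmul x
      _ = LieAlgebra.rank K L := hx

/-- The centres correspond under a bracket-preserving additive isomorphism. [folklore] -/
theorem mem_center_addEquiv_iff (j : L ≃+ L') (hlie : ∀ x y, j ⁅x, y⁆ = ⁅j x, j y⁆) (z : L) :
    j z ∈ LieAlgebra.center K L' ↔ z ∈ LieAlgebra.center K L := by
  change j z ∈ LieModule.maxTrivSubmodule K L' L' ↔ z ∈ LieModule.maxTrivSubmodule K L L
  rw [LieModule.mem_maxTrivSubmodule, LieModule.mem_maxTrivSubmodule]
  constructor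
  · intro h y
    have := h (j y)
    rw [← hlie] at this
    exact (map_eq_zero_iff j j.injective).mp this
  · intro h y'
    obtain ⟨y, rfl⟩ := j.surjective y'
    rw [← hlie, h y, map_zero]

/-- **The dimension of the centre is invariant under `σ`-semilinear isomorphisms of Lie
algebras.** [folklore] -/
theorem finrank_center_eq_of_semilinear (σ : K ≃+* K) (j : L ≃+ L')
    (hlie : ∀ x y, j ⁅x, y⁆ = ⁅j x, j y⁆) (hsmul : ∀ (c : K) (x : L), j (c • x) = σ c • j x) :
    Module.finrank K (LieAlgebra.center K L) = Module.finrank K (LieAlgebra.center K L') := by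
  let J : LieAlgebra.center K L ≃+ LieAlgebra.center K L' :=
    { toFun := fun z => ⟨j (z : L), (mem_center_addEquiv_iff j hlie _).mpr z.2⟩
      invFun := fun z' => ⟨j.symm (z' : L'),
        (mem_center_addEquiv_iff j hlie _).mp (by rw [j.apply_symm_apply]; exact z'.2)⟩
      left_inv := fun z => Subtype.ext (j.symm_apply_apply (z : L))
      right_inv := fun z' => Subtype.ext (j.apply_symm_apply (z' : L'))
      map_add' := fun a b => Subtype.ext (j.map_add (a : L) (b : L)) }
  have hJ : ∀ z : LieAlgebra.center K L, ((J z : LieAlgebra.center K L') : L') = j z :=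
    fun _ => rfl
  have hc : ∀ (c : K) (z : LieAlgebra.center K L), J (c • z) = σ c • J z := by
    intro c z
    apply Subtype.ext
    rw [hJ, LieSubmodule.coe_smul, LieSubmodule.coe_smul, hJ]
    exact hsmul c z
  exact congrArg Cardinal.toNat (rank_eq_of_equiv_equiv (σ : K → K) J σ.bijective hc)

/-! ### Honest isomorphisms of Lie algebras (`σ = 1`) -/

/-- Engel subalgebras of corresponding elements under `e : L ≃ₗ⁅K⁆ L'` have the same dimension.
[folklore] -/
theorem finrank_engel_eq_of_lieEquiv (e : L ≃ₗ⁅K⁆ L') (x : L) :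
    Module.finrank K (LieSubalgebra.engel K (e x)) = Module.finrank K (LieSubalgebra.engel K x) :=
  finrank_engel_eq_of_semilinear (RingEquiv.refl K) e.toLinearEquiv.toAddEquiv
    (fun x y => e.map_lie x y) (fun c x => e.map_smul c x) x

/-- **`LieAlgebra.rank` is invariant under isomorphisms of Lie algebras** (over an infinite
field). [folklore] -/
theorem rank_eq_of_lieEquiv {K : Type u} {L L' : Type v} [Field K] [Infinite K] [LieRing L]
    [LieAlgebra K L] [Module.Finite K L] [LieRing L'] [LieAlgebra K L'] [Module.Finite K L']
    (e : L ≃ₗ⁅K⁆ L') : LieAlgebra.rank K L = LieAlgebra.rank K L' :=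
  rank_eq_of_semilinear (RingEquiv.refl K) e.toLinearEquiv.toAddEquiv
    (fun x y => e.map_lie x y) (fun c x => e.map_smul c x)

/-- **The dimension of the centre is invariant under isomorphisms of Lie algebras.** [folklore] -/
theorem finrank_center_eq_of_lieEquiv (e : L ≃ₗ⁅K⁆ L') :
    Module.finrank K (LieAlgebra.center K L) = Module.finrank K (LieAlgebra.center K L') :=
  finrank_center_eq_of_semilinear (RingEquiv.refl K) e.toLinearEquiv.toAddEquiv
    (fun x y => e.map_lie x y) (fun c x => e.map_smul c x)

/-! ### The centre lies in every Engel subalgebra: `dim 𝔷 ≤ rank` -/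

/-- The centre of `L` lies in every Engel subalgebra (`ad x` kills the centre). [folklore] -/
theorem center_le_engel (x : L) :
    (LieAlgebra.center K L).toSubmodule ≤ (LieSubalgebra.engel K x).toSubmodule := by
  intro z hz
  rw [LieSubmodule.mem_toSubmodule] at hz
  rw [LieSubalgebra.mem_toSubmodule, LieSubalgebra.mem_engel_iff]
  refine ⟨1, ?_⟩
  rw [pow_one, LieAlgebra.ad_apply]
  exact (LieModule.mem_maxTrivSubmodule K L L z).1 hz x

/-- **`dim 𝔷(L) ≤ rank L`** over an infinite field: the centre lies in the Engel subalgebra of a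
regular element, whose dimension is the rank (so the truncated subtraction `rank L - dim 𝔷(L)`,
the rank of `L/𝔷(L)` for reductive `L`, loses nothing). [folklore] -/
theorem finrank_center_le_rank {K : Type u} {L : Type v} [Field K] [Infinite K] [LieRing L]
    [LieAlgebra K L] [Module.Finite K L] :
    Module.finrank K (LieAlgebra.center K L) ≤ LieAlgebra.rank K L := by
  obtain ⟨x, hx⟩ := LieAlgebra.exists_isRegular K L
  rw [LieAlgebra.isRegular_iff_finrank_engel_eq_rank] at hx
  rw [← hx]
  exact Submodule.finrank_mono (center_le_engel x)

end Literature.Algebra.Lie
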